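import Summits.HodgeConjecture.HodgeConjecture.Theses.LinearSystemTorelli
import Literature.AlgebraicGeometry.HodgeTheory.ComplexConjugationHolds
import Literature.AlgebraicGeometry.HodgeTheory.HodgeFiltrationModelsReductionProofs
import Literature.AlgebraicGeometry.HodgeTheory.HodgeFiltrationModels
import Literature.AlgebraicGeometry.HodgeTheory.LefschetzOneOne
import Literature.AlgebraicGeometry.HodgeTheory.HodgeTypeConjugation

/-!
# Crux `TranscendentalOrSupported` (stmt-HodgeConjecture-10853), line `Sketch` — stub `stub_cruxOne`:
# the calibration `p = 1` (surfaces), granted the rational Lefschetz `(1,1)` theorem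

Helper file for the line skeleton of the crux `TranscendentalOrSupported` of route
`LinearSystemTorelli` (GHC(2p, coniveau 1) in Grothendieck's sub-Hodge form), registered stub
`stub_cruxOne`: the instance `p = 1`. Notation: `X` a smooth projective SURFACE over `ℂ`
(`IsSmoothProjective (2 * 1) X`), `A` a Hodge model of `X`, `b : Fin r → H²(X(ℂ); ℂ)` rational
classes, `W := (span ℂ (range b)).map (A.pullback 2) ⊆ H²(X^an; ℂ)` their pulled-back span.

CLAIM (`stub_cruxOne`). Granted the rational Lefschetz `(1,1)` theorem (the tree's named fact
`lefschetzOneOne_rational`, Voisin I Thm. 11.30 with Cor. 11.34, taken as the hypothesis `hL`): if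
`W = ⨆_{p'+q'=2} W ⊓ H^{p',q'}` (a sub-Hodge structure of the model) and `W ⊓ H^{2,0} = ⊥`, then
every `b j` lies in `N¹ H²(X(ℂ); ℂ) = supportedClasses X 2 1 = algebraicClasses X 1` (divisor
classes).

PROOF. (1) `W` is stable under complex conjugation `conjClass` of `H²(X^an; ℂ)`: the span of the
rational classes `b j` is (`conjClass_mem_span_of_isRationalClass`: rational classes are real,
Voisin I Cor. 6.12), and conjugation commutes with the pull-back to the model
(`HodgeModel.pullback_conjClass`). (2) EVERY Hodge model of a smooth projective variety is Hodge
symmetric (`HodgeModel.isHodgeSymmetric`: `conj H^{a,b} ⊆ H^{b,a}`), so `conj (W ⊓ H^{0,2}) ⊆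
W ⊓ H^{2,0} = ⊥`, and `conj` being an involution, `W ⊓ H^{0,2} = ⊥` as well
(`cruxOne_inf_hodgePQ_eq_bot_of_isHodgeSymmetric`). (3) The index set `{p' + q' = 2}` is
`{(0,2), (1,1), (2,0)}`; the two extreme summands of the sub-Hodge decomposition of `W` vanish, so
`W ≤ H^{1,1}`: every `A^*(b j)` is of type `(1,1)`, i.e. `b j` is a rational class of Hodge type
`(1,1)` with witness `A`, and `hL` puts it in `algebraicClasses X 1`, which is
`supportedClasses X (2 * 1) 1` by definition.

References: C. Voisin, *Hodge Theory and Complex Algebraic Geometry I* (CUP 2002), §6.1.3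
Cor. 6.12, §7.1.1, §7.3.1, Thm. 11.30, Cor. 11.34 and §11.3.3; A. Grothendieck, *Hodge's general
conjecture is false for trivial reasons*, Topology 8 (1969), p. 300.
-/

-- `Summit.HodgeConjecture.HodgeConjecture.Theorems` is the mandated namespace (single-conjunct summit:
-- Sub = Summit), which `linter.dupNamespace` flags on every declaration; the lakefile turns the
-- linter off tree-wide (weak option), restated here so stand-alone elaboration is warning-free too.
set_option linter.dupNamespace false

noncomputable section

namespace Summit.HodgeConjecture.HodgeConjecture.Theorems

open Literature.AlgebraicGeometry.HodgeTheory Literature.AlgebraicGeometry.Motives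
open Literature.AlgebraicTopology.SingularHomology

variable {n : ℕ} {X : SchemeOver ℂ}

/-! ### Two Hodge-model lemmas -/

/-- **The pulled-back span of rational classes is stable under complex conjugation.** For a Hodge
model `A` of `X` and rational classes `b j ∈ Hᵏ(X(ℂ); ℂ)`, if `x ∈ Hᵏ(X^an; ℂ)` lies in the
pull-back `(span ℂ (range b)).map A^*` then so does `conj x`: `x = A^* c` with `c` in the span,
`conj (A^* c) = A^* (conj c)` (`HodgeModel.pullback_conjClass`, conjugation is computed on cochains)
and `conj c` lies in the span again (`conjClass_mem_span_of_isRationalClass`: `conj (b j) = b j`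
for the rational `b j`, and `conj` is additive and conjugate-linear).
[cite: VoisinHodgeI2002, §6.1.3 Cor. 6.12] -/
theorem cruxOne_conjClass_mem_map_span (A : HodgeModel n X) {k r : ℕ}
    {b : Fin r → complexBetti X k} (hb : ∀ j, IsRationalClass (b j))
    {x : singularCohomology ℂ ℂ A.carrier k}
    (hx : x ∈ (Submodule.span ℂ (Set.range b)).map (A.pullback k).hom) :
    conjClass A.carrier k x ∈ (Submodule.span ℂ (Set.range b)).map (A.pullback k).hom := by
  obtain ⟨c, hc, rfl⟩ := hx
  exact ⟨conjClass _ k c, conjClass_mem_span_of_isRationalClass hb hc, A.pullback_conjClass k c⟩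

/-- **Hodge symmetry swaps the vanishing of the pieces of a conjugation-stable subspace.** In a
Hodge symmetric model `A` (`conj H^{a,c} ⊆ H^{c,a}`, Voisin I Cor. 6.12), for a subspace
`W ⊆ Hᵏ(X^an; ℂ)` stable under `conj`: if `W ⊓ H^{a,c} = ⊥` then `W ⊓ H^{c,a} = ⊥` — for
`y ∈ W ⊓ H^{c,a}`, `conj y ∈ W ⊓ H^{a,c} = 0`, and `y = conj (conj y) = conj 0 = 0`.
[cite: VoisinHodgeI2002, §6.1.3 Cor. 6.12] -/
theorem cruxOne_inf_hodgePQ_eq_bot_of_isHodgeSymmetric (A : HodgeModel n X)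
    (hA : A.IsHodgeSymmetric) {k : ℕ} {W : Submodule ℂ (singularCohomology ℂ ℂ A.carrier k)}
    (hW : ∀ x ∈ W, conjClass A.carrier k x ∈ W) {a c : ℕ} (hac : W ⊓ A.hodgePQ k a c = ⊥) :
    W ⊓ A.hodgePQ k c a = ⊥ := by
  rw [eq_bot_iff]
  rintro y ⟨hyW, hy⟩
  have h1 : conjClass A.carrier k y ∈ W ⊓ A.hodgePQ k a c := ⟨hW y hyW, hA k c a y hy⟩
  rw [hac, Submodule.mem_bot] at h1
  rw [Submodule.mem_bot, ← conjClass_conjClass y, h1, conjClass_zero]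

/-! ### The stub -/

/-- **STUB `stub_cruxOne` — the calibration `p = 1` of the crux `TranscendentalOrSupported`, granted
the rational Lefschetz `(1,1)` theorem.** For a smooth projective surface `X / ℂ`, a Hodge model `A`,
rational classes `b j ∈ H²(X(ℂ); ℂ)` whose pulled-back span `W` satisfies
`W = ⨆_{p'+q'=2} W ⊓ H^{p',q'}` and `W ⊓ H^{2,0} = ⊥`: every `b j ∈ supportedClasses X 2 1`
(`= N¹ H² = algebraicClasses X 1`, the divisor classes). Proof: `W` is conjugation-stable
(`cruxOne_conjClass_mem_map_span`) and `A` is Hodge symmetric (`HodgeModel.isHodgeSymmetric`, every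
model of a smooth projective variety is), so `W ⊓ H^{0,2} = ⊥` too
(`cruxOne_inf_hodgePQ_eq_bot_of_isHodgeSymmetric`); of the three summands `(0,2), (1,1), (2,0)` of
the sub-Hodge decomposition of `W` only `W ⊓ H^{1,1}` survives, so `A^*(b j) ∈ H^{1,1}`, `b j` is a
rational class of Hodge type `(1,1)` (witness `A`), and `hL` (Voisin I Thm. 11.30, Cor. 11.34: the
Hodge conjecture in degree `2`) makes it a divisor class. [cite: VoisinHodgeI2002, Thm. 11.30, Cor. 11.34 and §11.3.3]
[cite: VoisinHodgeI2002, §6.1.3 Cor. 6.12 and §7.3.1] -/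
theorem stub_cruxOne (hL : lefschetzOneOne_rational) :
    ∀ ⦃X : SchemeOver ℂ⦄ (hX : IsSmoothProjective (2 * 1) X) (A : HodgeModel (2 * 1) X) (r : ℕ)
    (b : Fin r → complexBetti X (2 * 1)), (∀ j, IsRationalClass (b j)) →
    (Submodule.span ℂ (Set.range b)).map (A.pullback (2 * 1)).hom =
      ⨆ (p' : ℕ) (q' : ℕ) (_ : p' + q' = 2 * 1),
        (Submodule.span ℂ (Set.range b)).map (A.pullback (2 * 1)).hom ⊓ A.hodgePQ (2 * 1) p' q' →
    (Submodule.span ℂ (Set.range b)).map (A.pullback (2 * 1)).hom ⊓ A.hodgePQ (2 * 1) (2 * 1) 0 = ⊥ →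
    ∀ j, b j ∈ supportedClasses X (2 * 1) 1 := by
  intro X hX A r b hb hsub hbot j
  -- (1)+(2): no `(0,2)`-part either, by Hodge symmetry of `A` and conjugation-stability of `W`
  have h02 : (Submodule.span ℂ (Set.range b)).map (A.pullback (2 * 1)).hom ⊓
      A.hodgePQ (2 * 1) 0 (2 * 1) = ⊥ :=
    cruxOne_inf_hodgePQ_eq_bot_of_isHodgeSymmetric A (A.isHodgeSymmetric hX)
      (fun x hx ↦ cruxOne_conjClass_mem_map_span A hb hx) hbot
  -- (3): of the summands `(0,2), (1,1), (2,0)` only `W ⊓ H^{1,1}` survives, so `W ≤ H^{1,1}`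
  have hle : (Submodule.span ℂ (Set.range b)).map (A.pullback (2 * 1)).hom ≤
      A.hodgePQ (2 * 1) 1 1 := by
    refine hsub.le.trans (iSup_le fun p' ↦ iSup_le fun q' ↦ iSup_le fun hpq ↦ ?_)
    rcases Nat.lt_trichotomy p' 1 with hlt | rfl | hgt
    · obtain rfl : p' = 0 := by omega
      obtain rfl : q' = 2 * 1 := by omega
      rw [h02]
      exact bot_le
    · obtain rfl : q' = 1 := by omega
      exact inf_le_right
    · obtain rfl : p' = 2 * 1 := by omega
      obtain rfl : q' = 0 := by omega
      rw [hbot]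
      exact bot_le
  -- `b j` is a rational class of Hodge type `(1,1)` (witness `A`): Lefschetz `(1,1)` applies
  have h11 : A.pullback (2 * 1) (b j) ∈ A.hodgePQ (2 * 1) 1 1 :=
    hle (Submodule.mem_map_of_mem (Submodule.subset_span ⟨j, rfl⟩))
  exact hL hX (b j) (hb j) ⟨A, h11⟩

/-! ### Appended (lead c2, skeleton v5): the calibration `p = 1` from `MiddleDivisorSupport` -/

/-- **At `p = 1` the pulled-back span lies in `H^{1,1}`.** For a smooth projective surface `X`, a Hodge
model `A` and rational classes `b j ∈ H²(X(ℂ); ℂ)` whose pulled-back span `W` satisfies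
`W = ⨆_{p'+q'=2} W ⊓ H^{p',q'}` and `W ⊓ H^{2,0} = ⊥`: `W ≤ H^{1,1}`. Indeed `W` is
conjugation-stable (`cruxOne_conjClass_mem_map_span`) and `A` is Hodge symmetric
(`HodgeModel.isHodgeSymmetric`), so `W ⊓ H^{0,2} = ⊥` as well
(`cruxOne_inf_hodgePQ_eq_bot_of_isHodgeSymmetric`), and of the three summands `(0,2), (1,1), (2,0)`
of the sub-Hodge decomposition only `W ⊓ H^{1,1}` survives. In words: at `p = 1` a rationally
spanned sub-Hodge structure without `(2,0)`-part consists of Hodge classes — there are no phantom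
constituents on surfaces. [cite: VoisinHodgeI2002, §6.1.3 Cor. 6.12 and §7.1.1] -/
theorem cruxOne_map_span_le_hodgePQ_one_one
    ⦃X : SchemeOver ℂ⦄ (hX : IsSmoothProjective (2 * 1) X) (A : HodgeModel (2 * 1) X) {r : ℕ}
    {b : Fin r → complexBetti X (2 * 1)} (hb : ∀ j, IsRationalClass (b j))
    (hsub : (Submodule.span ℂ (Set.range b)).map (A.pullback (2 * 1)).hom =
      ⨆ (p' : ℕ) (q' : ℕ) (_ : p' + q' = 2 * 1),
        (Submodule.span ℂ (Set.range b)).map (A.pullback (2 * 1)).hom ⊓ A.hodgePQ (2 * 1) p' q')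
    (hbot : (Submodule.span ℂ (Set.range b)).map (A.pullback (2 * 1)).hom ⊓
      A.hodgePQ (2 * 1) (2 * 1) 0 = ⊥) :
    (Submodule.span ℂ (Set.range b)).map (A.pullback (2 * 1)).hom ≤ A.hodgePQ (2 * 1) 1 1 := by
  -- no `(0,2)`-part either, by Hodge symmetry of `A` and conjugation-stability of `W`
  have h02 : (Submodule.span ℂ (Set.range b)).map (A.pullback (2 * 1)).hom ⊓
      A.hodgePQ (2 * 1) 0 (2 * 1) = ⊥ :=
    cruxOne_inf_hodgePQ_eq_bot_of_isHodgeSymmetric A (A.isHodgeSymmetric hX)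
      (fun x hx ↦ cruxOne_conjClass_mem_map_span A hb hx) hbot
  refine hsub.le.trans (iSup_le fun p' ↦ iSup_le fun q' ↦ iSup_le fun hpq ↦ ?_)
  rcases Nat.lt_trichotomy p' 1 with hlt | rfl | hgt
  · obtain rfl : p' = 0 := by omega
    obtain rfl : q' = 2 * 1 := by omega
    rw [h02]
    exact bot_le
  · obtain rfl : q' = 1 := by omega
    exact inf_le_right
  · obtain rfl : p' = 2 * 1 := by omega
    obtain rfl : q' = 0 := by omega
    rw [hbot]
    exact bot_le

/-- **The calibration `p = 1` of the crux from `MiddleDivisorSupport` instead of Lefschetz `(1,1)`**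
(skeleton v5 of line `Sketch`: the literature debt `lefschetzOneOne_rational` leaves the crux's cone).
Granted the route item `MiddleDivisorSupport` (stmt-HodgeConjecture-1081: every rational `(p,p)`-class
in `H²ᵖ` of a smooth projective `2p`-fold, `p ≥ 1`, is supported on a divisor), for a smooth
projective surface `X`, a Hodge model `A`, rational `b j ∈ H²(X(ℂ); ℂ)` whose pulled-back span `W`
satisfies `W = ⨆_{p'+q'=2} W ⊓ H^{p',q'}` and `W ⊓ H^{2,0} = ⊥`: every `b j ∈ N¹ H²`. By
`cruxOne_map_span_le_hodgePQ_one_one`, `A^*(b j) ∈ H^{1,1}`, so `b j` is a rational class of Hodge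
type `(1,1)` (witness `A`) and `MiddleDivisorSupport` at `p = 1` supports it on a divisor.
[cite: VoisinHodgeI2002, §7.1.1 and §11.3.3] [cite: GrothendieckTopology1969, p. 300] -/
theorem stub_cruxOne_of_middleDivisorSupport
    (hMid : Summit.HodgeConjecture.HodgeConjecture.Theses.LinearSystemTorelli.MiddleDivisorSupport) :
    ∀ ⦃X : SchemeOver ℂ⦄ (hX : IsSmoothProjective (2 * 1) X) (A : HodgeModel (2 * 1) X) (r : ℕ)
    (b : Fin r → complexBetti X (2 * 1)), (∀ j, IsRationalClass (b j)) →
    (Submodule.span ℂ (Set.range b)).map (A.pullback (2 * 1)).hom =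
      ⨆ (p' : ℕ) (q' : ℕ) (_ : p' + q' = 2 * 1),
        (Submodule.span ℂ (Set.range b)).map (A.pullback (2 * 1)).hom ⊓ A.hodgePQ (2 * 1) p' q' →
    (Submodule.span ℂ (Set.range b)).map (A.pullback (2 * 1)).hom ⊓ A.hodgePQ (2 * 1) (2 * 1) 0 = ⊥ →
    ∀ j, b j ∈ supportedClasses X (2 * 1) 1 := by
  intro X hX A r b hb hsub hbot j
  exact hMid le_rfl hX (b j) (hb j) ⟨A, cruxOne_map_span_le_hodgePQ_one_one hX A hb hsub hbot
    (Submodule.mem_map_of_mem (Submodule.subset_span ⟨j, rfl⟩))⟩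

end Summit.HodgeConjecture.HodgeConjecture.Theorems

end
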